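import Mathlib
import Literature.Probability.LatticeModels.DiscreteParseval
import HarnessLib

/-!
# The quadratic bump, summation by parts against the equation, and `−Lθ` bounds

Helper file for item `stmt-CriticalPhenomena-4804`
(`Summit.CriticalPhenomena.Ising3DConformalLimit.Theses.PrecisionLaplacian.EtaBoundsTransfer`), part of its
unconditional proof: potential theory of inverse M-matrices ⇒ infinite-volume equation and Green-function
representation; Fourier analysis on `[-π,π]^d` ⇒ block-sum upper bounds; quadratic test function ⇒ ball-sum
lower bounds; Messager–Miracle-Solé ⇒ pointwise two-sided power bounds. No definitions are introduced: the
objects (kernel matrices, box sequences, convolution powers) enter through defining hypotheses.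
-/

namespace Summit.CriticalPhenomena.Ising3DConformalLimit.Theorems.EtaBoundsTransfer

open Finset Real Filter Topology Literature.Probability.LatticeModels
open scoped BigOperators

section TestFn

variable {d : ℕ}

/-! ### The quadratic bump `θ_R(u) = (1 − |u|²/R²)₊` -/

/-- Squared Euclidean length of a site, as a real number. -/
theorem sqLen_nonneg (u : Site d) : 0 ≤ ∑ j, ((u j : ℝ)) ^ 2 :=
  Finset.sum_nonneg fun _ _ => sq_nonneg _

/-- The parallelogram law on `ℤ^d`: `|u+y|² + |u−y|² − 2|u|² = 2|y|²`. -/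
theorem sqLen_parallelogram (u y : Site d) :
    (∑ j, (((u + y) j : ℝ)) ^ 2) + (∑ j, (((u - y) j : ℝ)) ^ 2) - 2 * ∑ j, ((u j : ℝ)) ^ 2
      = 2 * ∑ j, ((y j : ℝ)) ^ 2 := by
  rw [Finset.mul_sum, Finset.mul_sum, ← Finset.sum_add_distrib, ← Finset.sum_sub_distrib]
  refine Finset.sum_congr rfl fun j _ => ?_
  push_cast [Pi.add_apply, Pi.sub_apply]
  ring

/-- A site with `|u|² < R²` lies in the box `Λ_R`. -/
theorem mem_box_of_sqLen_lt {R : ℕ} {u : Site d} (hu : ∑ j, ((u j : ℝ)) ^ 2 < (R : ℝ) ^ 2) :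
    u ∈ box d R := by
  rw [mem_box]
  intro i
  have h1 : ((u i : ℝ)) ^ 2 ≤ ∑ j, ((u j : ℝ)) ^ 2 :=
    Finset.single_le_sum (fun j _ => sq_nonneg ((u j : ℝ))) (Finset.mem_univ i)
  have h2 : ((u i : ℝ)) ^ 2 < (R : ℝ) ^ 2 := lt_of_le_of_lt h1 hu
  have h3 : |(u i : ℝ)| < R := abs_lt_of_sq_lt_sq h2 (Nat.cast_nonneg R)
  have h4 : |(u i : ℝ)| = ((|u i| : ℤ) : ℝ) := by push_cast; rfl
  rw [h4] at h3
  have h5 : |u i| < (R : ℤ) := by exact_mod_cast h3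
  have h6 := abs_lt.1 h5
  constructor <;> omega

/-- **Second-difference bound for the bump**: with `θ(u) = max 0 (1 − |u|²/R²)`,
`2θ(u) − θ(u+y) − θ(u−y) ≤ 2 min(1, |y|²/R²)` whenever `|u|² < R²`. -/
theorem bump_second_diff_le {R : ℝ} (hR : 0 < R) {u : Site d}
    (hu : ∑ j, ((u j : ℝ)) ^ 2 < R ^ 2) (y : Site d) :
    2 * max 0 (1 - (∑ j, ((u j : ℝ)) ^ 2) / R ^ 2)
      - max 0 (1 - (∑ j, (((u + y) j : ℝ)) ^ 2) / R ^ 2)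
      - max 0 (1 - (∑ j, (((u - y) j : ℝ)) ^ 2) / R ^ 2)
      ≤ 2 * min 1 ((∑ j, ((y j : ℝ)) ^ 2) / R ^ 2) := by
  have hR2 : 0 < R ^ 2 := by positivity
  have hin : 0 ≤ 1 - (∑ j, ((u j : ℝ)) ^ 2) / R ^ 2 := by
    rw [sub_nonneg, div_le_one hR2]; exact hu.le
  rw [max_eq_right hin]
  rcases le_total 1 ((∑ j, ((y j : ℝ)) ^ 2) / R ^ 2) with h | h
  · rw [min_eq_left h]
    have h1 : 0 ≤ max 0 (1 - (∑ j, (((u + y) j : ℝ)) ^ 2) / R ^ 2) := le_max_left _ _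
    have h2 : 0 ≤ max 0 (1 - (∑ j, (((u - y) j : ℝ)) ^ 2) / R ^ 2) := le_max_left _ _
    have h3 : (∑ j, ((u j : ℝ)) ^ 2) / R ^ 2 ≥ 0 := div_nonneg (sqLen_nonneg u) hR2.le
    linarith
  · rw [min_eq_right h]
    have h1 : 1 - (∑ j, (((u + y) j : ℝ)) ^ 2) / R ^ 2 ≤ max 0 (1 - (∑ j, (((u + y) j : ℝ)) ^ 2) / R ^ 2) :=
      le_max_right _ _
    have h2 : 1 - (∑ j, (((u - y) j : ℝ)) ^ 2) / R ^ 2 ≤ max 0 (1 - (∑ j, (((u - y) j : ℝ)) ^ 2) / R ^ 2) :=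
      le_max_right _ _
    have hpar := sqLen_parallelogram u y
    have key : 2 * (1 - (∑ j, ((u j : ℝ)) ^ 2) / R ^ 2) - (1 - (∑ j, (((u + y) j : ℝ)) ^ 2) / R ^ 2)
        - (1 - (∑ j, (((u - y) j : ℝ)) ^ 2) / R ^ 2) = 2 * ((∑ j, ((y j : ℝ)) ^ 2) / R ^ 2) := by
      field_simp
      linarith
    linarith

/-! ### Summation by parts against a finitely supported test function -/

/-- The double family `(y, u) ↦ b(y) G(u) (θ(u) − θ(u+y))` is summable when `b ≥ 0` is
summable, `0 ≤ G ≤ G₀` and `θ` is bounded by `1` and finitely supported. -/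
theorem summable_uncurry_bump {G b θ : Site d → ℝ} {G₀ : ℝ} (hG0 : ∀ u, 0 ≤ G u)
    (hGle : ∀ u, G u ≤ G₀) (hb0 : ∀ y, 0 ≤ b y) (hbs : Summable b)
    {F : Finset (Site d)} (hθF : ∀ u, u ∉ F → θ u = 0) (hθ1 : ∀ u, |θ u| ≤ 1) :
    Summable (Function.uncurry fun y u => b y * G u * (θ u - θ (u + y))) := by
  have hG₀ : 0 ≤ G₀ := (hG0 0).trans (hGle 0)
  have hind : Summable (fun u : Site d => if u ∈ F then (1:ℝ) else 0) := by
    apply summable_of_ne_finset_zero (s := F)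
    intro u hu; rw [if_neg hu]
  have hind0 : ∀ u : Site d, 0 ≤ (if u ∈ F then (1:ℝ) else 0) := fun u => by split_ifs <;> norm_num
  have hfam1 : Summable (fun p : Site d × Site d => b p.1 * (if p.2 ∈ F then (1:ℝ) else 0)) :=
    Summable.mul_of_nonneg (f := b) (g := fun u : Site d => if u ∈ F then (1:ℝ) else 0) hbs hind
      (fun y => hb0 y) hind0
  have hfam2 : Summable (fun p : Site d × Site d => b p.1 * (if p.2 + p.1 ∈ F then (1:ℝ) else 0)) := by
    have e := Equiv.prodShear (Equiv.refl (Site d)) (fun y : Site d => Equiv.addRight y)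
    have key : (fun p : Site d × Site d => b p.1 * (if p.2 + p.1 ∈ F then (1:ℝ) else 0))
        = (fun p : Site d × Site d => b p.1 * (if p.2 ∈ F then (1:ℝ) else 0))
          ∘ (Equiv.prodShear (Equiv.refl (Site d)) (fun y : Site d => Equiv.addRight y)) := by
      funext p
      rfl
    rw [key]
    exact (Equiv.summable_iff _).2 hfam1
  refine Summable.of_norm_bounded ((hfam1.add hfam2).mul_left G₀) ?_
  rintro ⟨y, u⟩
  rw [Function.uncurry_apply_pair, Real.norm_eq_abs, abs_mul, abs_mul, abs_of_nonneg (hb0 y),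
    abs_of_nonneg (hG0 u)]
  have hθu : |θ u| ≤ (if u ∈ F then (1:ℝ) else 0) := by
    split_ifs with h
    · exact hθ1 u
    · rw [hθF u h, abs_zero]
  have hθuy : |θ (u + y)| ≤ (if u + y ∈ F then (1:ℝ) else 0) := by
    split_ifs with h
    · exact hθ1 _
    · rw [hθF _ h, abs_zero]
  calc b y * G u * |θ u - θ (u + y)| ≤ b y * G₀ * (|θ u| + |θ (u + y)|) :=
        mul_le_mul (mul_le_mul_of_nonneg_left (hGle u) (hb0 y)) (abs_sub _ _) (abs_nonneg _)
          (mul_nonneg (hb0 y) hG₀)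
    _ ≤ b y * G₀ * ((if u ∈ F then (1:ℝ) else 0) + (if u + y ∈ F then (1:ℝ) else 0)) :=
        mul_le_mul_of_nonneg_left (add_le_add hθu hθuy) (mul_nonneg (hb0 y) hG₀)
    _ = G₀ * (b y * (if u ∈ F then (1:ℝ) else 0) + b y * (if u + y ∈ F then (1:ℝ) else 0)) := by ring

/-- The outer family `u ↦ G(u) ∑_y b(y)(θ(u) − θ(u+y))` is summable. -/
theorem summable_outer_bump {G b θ : Site d → ℝ} {G₀ : ℝ} (hG0 : ∀ u, 0 ≤ G u)
    (hGle : ∀ u, G u ≤ G₀) (hb0 : ∀ y, 0 ≤ b y) (hbs : Summable b)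
    {F : Finset (Site d)} (hθF : ∀ u, u ∉ F → θ u = 0) (hθ1 : ∀ u, |θ u| ≤ 1) :
    Summable (fun u => G u * ∑' y, b y * (θ u - θ (u + y))) := by
  have h := (summable_uncurry_bump hG0 hGle hb0 hbs hθF hθ1).prod_symm.prod
  refine h.congr fun u => ?_
  rw [← tsum_mul_left]
  refine tsum_congr fun y => ?_
  show b y * G u * (θ u - θ (u + y)) = G u * (b y * (θ u - θ (u + y)))
  ring

/-- **Summation by parts**: if `A₀ G(z) − ∑_y b(y) G(z−y) = δ_{z0}` with `∑ b = A₀`, `b ≥ 0`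
summable, `0 ≤ G ≤ G₀`, and `θ` is supported in a finite set `F ∋ 0` with `|θ| ≤ 1`, then
`θ(0) = ∑_u G(u) · ∑_y b(y) (θ(u) − θ(u+y))`. -/
theorem summation_by_parts {G b θ : Site d → ℝ} {A₀ G₀ : ℝ} (hG0 : ∀ u, 0 ≤ G u)
    (hGle : ∀ u, G u ≤ G₀) (hb0 : ∀ y, 0 ≤ b y) (hbs : Summable b) (hbA : ∑' y, b y = A₀)
    (heq : ∀ z, A₀ * G z - ∑' y, b y * G (z - y) = if z = 0 then 1 else 0)
    {F : Finset (Site d)} (hF0 : (0 : Site d) ∈ F) (hθF : ∀ u, u ∉ F → θ u = 0)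
    (hθ1 : ∀ u, |θ u| ≤ 1) :
    θ 0 = ∑' u, G u * ∑' y, b y * (θ u - θ (u + y)) := by
  have hG₀ : 0 ≤ G₀ := (hG0 0).trans (hGle 0)
  have hsG : ∀ z, Summable (fun y => b y * G (z - y)) := fun z =>
    Summable.of_nonneg_of_le (fun y => mul_nonneg (hb0 y) (hG0 _))
      (fun y => mul_le_mul_of_nonneg_left (hGle _) (hb0 y)) (hbs.mul_right G₀)
  have hΦs := summable_uncurry_bump hG0 hGle hb0 hbs hθF hθ1
  -- Step 1: `θ 0 = ∑_{z ∈ F} θ z (A₀ G z - ∑ b y G(z-y))`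
  have h1 : θ 0 = ∑ z ∈ F, θ z * (A₀ * G z - ∑' y, b y * G (z - y)) := by
    have : ∀ z, θ z * (A₀ * G z - ∑' y, b y * G (z - y)) = if z = 0 then θ z else 0 := by
      intro z; rw [heq z]; split_ifs <;> simp
    rw [Finset.sum_congr rfl (fun z _ => this z), Finset.sum_ite_eq' F (0 : Site d) θ, if_pos hF0]
  -- Step 2: `A₀ G z - ∑ b y G (z - y) = ∑ b y (G z - G (z - y))`
  have h2 : ∀ z, A₀ * G z - ∑' y, b y * G (z - y) = ∑' y, b y * (G z - G (z - y)) := by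
    intro z
    have : (fun y => b y * (G z - G (z - y))) = fun y => b y * G z - b y * G (z - y) := by
      funext y; ring
    rw [this, Summable.tsum_sub (hbs.mul_right _) (hsG z), tsum_mul_right, hbA]
  -- Step 3: swap the finite sum and the series, and substitute `z = u + y`
  have h3 : ∀ y, ∑ z ∈ F, θ z * (b y * (G z - G (z - y)))
      = ∑' u, b y * G u * (θ u - θ (u + y)) := by
    intro y
    have hfin : ∀ z, z ∉ F → θ z * (b y * (G z - G (z - y))) = 0 := fun z hz => by
      rw [hθF z hz, zero_mul]
    have e0 : ∑' z, θ z * (b y * (G z - G (z - y))) = ∑ z ∈ F, θ z * (b y * (G z - G (z - y))) :=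
      tsum_eq_sum (fun z hz => hfin z hz)
    rw [← e0]
    have hs1 : Summable fun z => θ z * (b y * G z) :=
      summable_of_ne_finset_zero (s := F) (fun z hz => by rw [hθF z hz, zero_mul])
    have hs2 : Summable fun z => θ z * (b y * G (z - y)) :=
      summable_of_ne_finset_zero (s := F) (fun z hz => by rw [hθF z hz, zero_mul])
    have hs3 : Summable fun u => θ (u + y) * (b y * G u) := by
      apply summable_of_ne_finset_zero (s := F.image fun z => z - y)
      intro u hu
      have : u + y ∉ F := fun h => hu (Finset.mem_image.2 ⟨u + y, h, by abel⟩)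
      rw [hθF (u + y) this, zero_mul]
    have e1 : ∑' z, θ z * (b y * (G z - G (z - y)))
        = ∑' z, θ z * (b y * G z) - ∑' z, θ z * (b y * G (z - y)) := by
      rw [← Summable.tsum_sub hs1 hs2]; refine tsum_congr fun z => ?_; ring
    have e2 : ∑' z, θ z * (b y * G (z - y)) = ∑' u, θ (u + y) * (b y * G u) := by
      rw [← (Equiv.addRight y).tsum_eq (fun z => θ z * (b y * G (z - y)))]
      refine tsum_congr fun u => ?_
      rw [Equiv.coe_addRight, add_sub_cancel_right]
    rw [e1, e2, ← Summable.tsum_sub hs1 hs3]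
    refine tsum_congr fun u => ?_
    ring
  have hs5 : ∀ z, Summable fun y => θ z * (b y * (G z - G (z - y))) := fun z => by
    have := ((hbs.mul_right (G z)).sub (hsG z)).mul_left (θ z)
    refine this.congr fun y => ?_
    ring
  have h4 : ∑ z ∈ F, θ z * ∑' y, b y * (G z - G (z - y))
      = ∑' y, ∑ z ∈ F, θ z * (b y * (G z - G (z - y))) := by
    rw [Summable.tsum_finsetSum (fun z _ => hs5 z)]
    refine Finset.sum_congr rfl fun z _ => ?_
    rw [← tsum_mul_left]
  rw [h1]
  simp_rw [h2]
  rw [h4]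
  simp_rw [h3]
  -- Step 4: swap the two series
  have h5 : ∑' y, ∑' u, b y * G u * (θ u - θ (u + y)) = ∑' u, ∑' y, b y * G u * (θ u - θ (u + y)) :=
    hΦs.tsum_comm.symm
  rw [h5]
  refine tsum_congr fun u => ?_
  rw [← tsum_mul_left]
  refine tsum_congr fun y => ?_
  ring

end TestFn

end Summit.CriticalPhenomena.Ising3DConformalLimit.Theorems.EtaBoundsTransfer

namespace Summit.CriticalPhenomena.Ising3DConformalLimit.Theorems.EtaBoundsTransfer

open Finset Real Filter Topology MeasureTheory Literature.Probability.LatticeModels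
open scoped BigOperators

section TestFn2

variable {d : ℕ}

/-! ### The action of `−L` on the bump -/

/-- Summability of `y ↦ b(y) (θ(u) − θ(u+y))` for a test function bounded by `1`. -/
theorem summable_b_mul_diff {b θ : Site d → ℝ} (hb0 : ∀ y, 0 ≤ b y) (hbs : Summable b)
    (hθ1 : ∀ u, |θ u| ≤ 1) (u : Site d) : Summable (fun y => b y * (θ u - θ (u + y))) := by
  refine Summable.of_norm_bounded (hbs.mul_right 2) fun y => ?_
  rw [Real.norm_eq_abs, abs_mul, abs_of_nonneg (hb0 y)]
  refine mul_le_mul_of_nonneg_left ?_ (hb0 y)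
  calc |θ u - θ (u + y)| ≤ |θ u| + |θ (u + y)| := abs_sub _ _
    _ ≤ 1 + 1 := add_le_add (hθ1 _) (hθ1 _)
    _ = 2 := by norm_num

/-- The bump `θ_R(u) = max 0 (1 − |u|²/R²)` is bounded by `1` in absolute value. -/
theorem abs_bump_le_one {R : ℝ} (u : Site d) :
    |max 0 (1 - (∑ j, ((u j : ℝ)) ^ 2) / R ^ 2)| ≤ 1 := by
  rw [abs_of_nonneg (le_max_left _ _)]
  refine max_le zero_le_one ?_
  have : 0 ≤ (∑ j, ((u j : ℝ)) ^ 2) / R ^ 2 := div_nonneg (sqLen_nonneg u) (sq_nonneg _)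
  linarith

/-- **Outside the ball `−Lθ ≤ 0`**: if `θ(u) = 0` then `∑_y b(y)(θ(u) − θ(u+y)) ≤ 0`. -/
theorem neg_L_bump_nonpos {b : Site d → ℝ} (hb0 : ∀ y, 0 ≤ b y) {R : ℝ} {u : Site d}
    (hu : R ^ 2 ≤ ∑ j, ((u j : ℝ)) ^ 2) (hR : 0 < R) :
    ∑' y, b y * (max 0 (1 - (∑ j, ((u j : ℝ)) ^ 2) / R ^ 2)
      - max 0 (1 - (∑ j, (((u + y) j : ℝ)) ^ 2) / R ^ 2)) ≤ 0 := by
  have hθu : max 0 (1 - (∑ j, ((u j : ℝ)) ^ 2) / R ^ 2) = 0 := by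
    refine max_eq_left ?_
    rw [sub_nonpos, le_div_iff₀ (by positivity)]; linarith
  rw [hθu]
  refine tsum_nonpos fun y => ?_
  have : 0 ≤ max 0 (1 - (∑ j, (((u + y) j : ℝ)) ^ 2) / R ^ 2) := le_max_left _ _
  nlinarith [hb0 y]

/-- **Inside the ball `−Lθ ≤ ∑_y b(y) min(1, |y|²/R²)`** (symmetrisation by evenness of `b` and
the second-difference bound for the quadratic bump). -/
theorem neg_L_bump_le {b : Site d → ℝ} (hb0 : ∀ y, 0 ≤ b y) (hbs : Summable b)
    (hbev : ∀ y, b (-y) = b y) {R : ℝ} (hR : 0 < R) {u : Site d}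
    (hu : ∑ j, ((u j : ℝ)) ^ 2 < R ^ 2) :
    ∑' y, b y * (max 0 (1 - (∑ j, ((u j : ℝ)) ^ 2) / R ^ 2)
      - max 0 (1 - (∑ j, (((u + y) j : ℝ)) ^ 2) / R ^ 2))
      ≤ ∑' y, b y * min 1 ((∑ j, ((y j : ℝ)) ^ 2) / R ^ 2) := by
  set θ : Site d → ℝ := fun v => max 0 (1 - (∑ j, ((v j : ℝ)) ^ 2) / R ^ 2) with hθ
  have hθ1 : ∀ v, |θ v| ≤ 1 := fun v => abs_bump_le_one v
  have hs1 : Summable (fun y => b y * (θ u - θ (u + y))) := summable_b_mul_diff hb0 hbs hθ1 u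
  have hs2 : Summable (fun y => b y * (θ u - θ (u - y))) := by
    have := summable_b_mul_diff hb0 hbs hθ1 u
    rw [← (Equiv.neg (Site d)).summable_iff] at this
    refine this.congr fun y => ?_
    simp only [Function.comp_apply, Equiv.neg_apply, hbev, sub_eq_add_neg]
  have hsm : Summable (fun y => b y * min 1 ((∑ j, ((y j : ℝ)) ^ 2) / R ^ 2)) := by
    refine Summable.of_nonneg_of_le (fun y => mul_nonneg (hb0 y) (le_min zero_le_one
      (div_nonneg (sqLen_nonneg y) (sq_nonneg R)))) (fun y => ?_) hbs
    exact mul_le_of_le_one_right (hb0 y) (min_le_left _ _)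
  -- symmetrisation
  have hsymm : ∑' y, b y * (θ u - θ (u + y)) = ∑' y, b y * (θ u - θ (u - y)) := by
    rw [← (Equiv.neg (Site d)).tsum_eq (fun y => b y * (θ u - θ (u + y)))]
    refine tsum_congr fun y => ?_
    simp only [Equiv.neg_apply, hbev, sub_eq_add_neg]
  have h2 : 2 * ∑' y, b y * (θ u - θ (u + y))
      = ∑' y, b y * (2 * θ u - θ (u + y) - θ (u - y)) := by
    rw [two_mul]
    conv_lhs => rw [hsymm]; rw [← hsymm]
    nth_rewrite 2 [hsymm]
    rw [← Summable.tsum_add hs1 hs2]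
    refine tsum_congr fun y => ?_
    ring
  have h3 : ∑' y, b y * (2 * θ u - θ (u + y) - θ (u - y))
      ≤ ∑' y, b y * (2 * min 1 ((∑ j, ((y j : ℝ)) ^ 2) / R ^ 2)) := by
    refine Summable.tsum_le_tsum (fun y => ?_) ?_ ?_
    · exact mul_le_mul_of_nonneg_left (bump_second_diff_le hR hu y) (hb0 y)
    · have : (fun y => b y * (2 * θ u - θ (u + y) - θ (u - y)))
          = fun y => b y * (θ u - θ (u + y)) + b y * (θ u - θ (u - y)) := by
        funext y; ring
      rw [this]; exact hs1.add hs2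
    · have : (fun y => b y * (2 * min 1 ((∑ j, ((y j : ℝ)) ^ 2) / R ^ 2)))
          = fun y => 2 * (b y * min 1 ((∑ j, ((y j : ℝ)) ^ 2) / R ^ 2)) := by
        funext y; ring
      rw [this]; exact hsm.mul_left 2
  have h4 : ∑' y, b y * (2 * min 1 ((∑ j, ((y j : ℝ)) ^ 2) / R ^ 2))
      = 2 * ∑' y, b y * min 1 ((∑ j, ((y j : ℝ)) ^ 2) / R ^ 2) := by
    rw [← tsum_mul_left]; refine tsum_congr fun y => ?_; ring
  linarith [h2, h3, h4]

end TestFn2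

end Summit.CriticalPhenomena.Ising3DConformalLimit.Theorems.EtaBoundsTransfer
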